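import Literature.Computability.Complexity.StackWordArith
import Literature.Computability.Complexity.StackBricks
import Literature.Computability.Cryptography.WordRAMToTM2Memory
import Literature.Computability.Cryptography.WordRAMBounds
import HarnessLib

/-!
# Word-RAM programs on multi-stack machines, II: the interpreter

Family `fine-grained` / trunk `CplxCore`, continuing `WordRAMToTM2Memory.lean` (register file,
memory log) with the word operations of `StackWordArith.lean`. This file is the interpreter of an
arbitrary word-RAM program `M` (`Literature/Computability/Cryptography/WordRAM.lean`, oracle-free,
coins zero) by a structured stack program `interp M : Com (K ⊕ AReg)`, with its simulation
theorem, step for step, and an explicit polynomial cost — the machine-level content of the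
folklore "random-access machines are simulated by multitape Turing machines with polynomial
overhead" (Cook–Reckhow 1973, §2; Korte–Vygen 2002, §15.2) in the form needed for the machine-model
step `sparseKSATInExpTime_of_liberalSparseKSATInRAMTime` of `CliqueETHTMBridge.lean`.

* `wregs`, `IClean`, `opW` / `runs_opW` — the twelve operations `BinOp.eval W` on the bank
  (`opCost = 250 (W + |x| + |y| + 1)²`);
* `loadTo` / `runs_loadTo`, `storeDst` / `runs_storeDst` (`storeEntries`,
  `represents_storeEntries`) — operands (`imm`/`dir`/`ind`) read into a bank register and written
  from `x` through the log (`memRead`/`memWrite`);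
* `cfgSt W E pc run` — the register file of a configuration between two steps: log, ruler `1^W`,
  program counter in unary (`pcEnc`; empty when halted), run flag; `instrCode i I`, `next`,
  `dispatchL`/`body`/`interp` — the code of an instruction, the dispatch on the unary counter
  (one guarded pop per program position), the interpreter loop on the run flag;
* `runs_instrCode` — **one instruction** (all six kinds, against `WordRAM.step` with `noOracle`
  and `zeroCoins`: `rand` writes `0`, `query` writes the empty answer's length `0`);
  `runs_dispatchL_hit/miss`, `runs_body_step` — **one step of the RAM**;
  `runs_interp` — **a halting run of `n` steps** is simulated within
  `n · (instrCost((4β+4)(|E|+n)) + 2 pcBound + 5) + 1` steps, where `β` bounds the bit length of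
  all numerals (`(encodeNat V).length ≤ β` for the value bound `V` of `WordRAMBounds.lean`) and
  `pcBound M = |M| + max jump target`; the log grows by at most one entry per step;
* `readOutBit` / `runs_readOutBit` (the answer bit of a `[0]`/`[1]`-valued machine),
  `cleanup` / `runs_cleanup`, `init_inp` / `init_out` (Mathlib's `Regs.init` as states),
  `logLookup_of_mem_of_nodup` (logs with distinct keys may be built in any order).

Proof technique throughout: routines are written left-nested and their specifications are
assembled left to right by `Runs.seq`, the register file being normalised to `state ρ F` by
`simp` between steps ("symbolic execution by unification").

## References

* S. A. Cook, R. A. Reckhow, *Time bounded random access machines*, JCSS 7 (1973) 354–375, §2.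
* B. Korte, J. Vygen, *Combinatorial Optimization*, Springer 2002, §15.2, p. 341.
* T. Hagerup, *Sorting and searching on the word RAM*, STACS 1998, §2 (the machine model).
* T. Nipkow, G. Klein, *Concrete Semantics with Isabelle/HOL*, Springer 2014, Ch. 7–8.
-/

namespace Literature.Computability.Cryptography.WordRAM.ToTM2

open _root_.Computability Complexity Complexity.Com St

/-! ### The outer registers of the word operations -/

/-- The outer registers of the word operations inside the main register file. [folklore] -/
def wregs : WRegs K where
  w := .wr
  c := .cn
  c2 := .cn2
  m := .msb
  q := .quo
  p := .scr
  w_c := by decide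
  w_c2 := by decide
  w_m := by decide
  w_q := by decide
  w_p := by decide
  c_c2 := by decide
  c_m := by decide
  c_q := by decide
  c_p := by decide
  c2_m := by decide
  c2_q := by decide
  c2_p := by decide
  m_q := by decide
  m_p := by decide
  q_p := by decide

/-- `IClean ρ W E`: the main register file holds the log of `E`, the ruler `1^W`, and all the
scratch registers of the memory routines and of the word operations are empty. [folklore] -/
structure IClean (ρ : St) (W : ℕ) (E : List (List Bool × List Bool)) : Prop where
  mem : ρ.mem = encLog E
  wr : ρ.wr = ones W
  cn : ρ.cn = []
  cn2 : ρ.cn2 = []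
  msb : ρ.msb = []
  quo : ρ.quo = []
  scr : ρ.scr = []
  mem2 : ρ.mem2 = []
  key : ρ.key = []
  key2 : ρ.key2 = []
  val : ρ.val = []
  st1 : ρ.st1 = []
  st2 : ρ.st2 = []
  ph : ρ.ph = []
  eqf : ρ.eqf = []
  found : ρ.found = []
  tmp : ρ.tmp = []

/-- A clean file makes the outer registers of the word operations clean. [folklore] -/
theorem IClean.wclean {ρ : St} {W : ℕ} {E : List (List Bool × List Bool)} (h : IClean ρ W E) :
    wregs.Clean ρ.regs W :=
  ⟨h.wr, h.cn, h.cn2, h.msb, h.quo, h.scr⟩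

/-- Replacing the log keeps the file clean. [folklore] -/
theorem IClean.with_mem {ρ : St} {W : ℕ} {E E' : List (List Bool × List Bool)} (h : IClean ρ W E) :
    IClean { ρ with mem := encLog E' } W E' :=
  ⟨rfl, h.wr, h.cn, h.cn2, h.msb, h.quo, h.scr, h.mem2, h.key, h.key2, h.val, h.st1, h.st2, h.ph, h.eqf, h.found, h.tmp⟩

/-! ### The word operations -/

/-- The dispatcher on the twelve operations. [folklore] -/
def opW : BinOp → Com (K ⊕ AReg)
  | .add => addW wregs
  | .sub => subW wregs
  | .mul => mulW wregs
  | .div => divW wregs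
  | .mod => modW wregs
  | .band => bandW
  | .bor => borW wregs
  | .bxor => bxorW wregs
  | .shl => shlW wregs
  | .shr => shrW wregs
  | .lt => ltW
  | .eq => eqW

/-- The uniform cost bound of one word operation. [folklore] -/
def opCost (W la lb : ℕ) : ℕ := 250 * (W + la + lb + 1) ^ 2

/-- `opCost` dominates the quadratic bounds of the long operations. [folklore] -/
theorem opCost_ge_sq (W la lb c : ℕ) (hc : c ≤ 250) : c * (W + la + lb + 1) ^ 2 ≤ opCost W la lb := by
  unfold opCost; exact Nat.mul_le_mul_right _ hc

/-- `opCost` dominates the linear bounds. [folklore] -/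
theorem opCost_ge_lin (W la lb c d : ℕ) (hc : c + d ≤ 250) : c * (W + la + lb) + d ≤ opCost W la lb := by
  unfold opCost; nlinarith

/-- `opCost` dominates the bounds of the shifts. [folklore] -/
theorem opCost_ge_shift (W la lb X : ℕ) (hX : X ≤ W + la + lb) :
    60 * (X + 1) ^ 2 + 80 * (W + la + lb) + 80 ≤ opCost W la lb := by
  unfold opCost; nlinarith

/-- **The word operations compute `BinOp.eval W`** on canonical numerals, within `opCost`.
[folklore] -/
theorem runs_opW {ρ : St} {W : ℕ} {E : List (List Bool × List Bool)} (h : IClean ρ W E) (o : BinOp) (a b : ℕ) :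
    Runs (opW o) (state ρ (AReg.file (encodeNat a) (encodeNat b) [] [] [] [] [] []))
      (state ρ (AReg.file (encodeNat (o.eval W a b)) [] [] [] [] [] [] []))
      (opCost W (encodeNat a).length (encodeNat b).length) := by
  have hT := h.wclean
  have e3 : ∀ c, c * ((encodeNat a).length + (encodeNat b).length + 1) ^ 2 ≤
      c * (W + (encodeNat a).length + (encodeNat b).length + 1) ^ 2 := fun c =>
    Nat.mul_le_mul_left _ (Nat.pow_le_pow_left (by omega) 2)
  cases o with
  | add =>
    refine (runs_addW wregs hT (encodeNat a) (encodeNat b)).of_eq ?_ (opCost_ge_lin _ _ _ 44 53 (by norm_num))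
    simp [BinOp.eval, bitsToNat_encodeNat]
  | sub =>
    refine (runs_subW wregs hT (encodeNat a) (encodeNat b)).of_eq ?_ (by unfold opCost; nlinarith)
    simp [BinOp.eval, bitsToNat_encodeNat]
  | mul =>
    refine (runs_mulW wregs hT (encodeNat a) (encodeNat b)).of_eq ?_ (opCost_ge_sq _ _ _ 50 (by norm_num))
    simp [BinOp.eval, bitsToNat_encodeNat]
  | div =>
    refine (runs_divW wregs hT (encodeNat a) b).of_eq ?_ ((e3 48).trans (opCost_ge_sq _ _ _ 48 (by norm_num)))
    simp [BinOp.eval, bitsToNat_encodeNat]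
  | mod =>
    refine (runs_modW wregs hT a b).of_eq ?_ ((e3 48).trans (opCost_ge_sq _ _ _ 48 (by norm_num)))
    simp [BinOp.eval]
  | band =>
    refine (runs_bandW ρ.regs (encodeNat a) (encodeNat b)).of_eq ?_
      (le_trans (by omega) (opCost_ge_lin W _ _ 17 8 (by norm_num)))
    simp [BinOp.eval, bitsToNat_encodeNat]
  | bor =>
    refine (runs_borW wregs hT (encodeNat a) (encodeNat b)).of_eq ?_ (opCost_ge_lin _ _ _ 46 19 (by norm_num))
    simp [BinOp.eval, bitsToNat_encodeNat]
  | bxor =>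
    refine (runs_bxorW wregs hT (encodeNat a) (encodeNat b)).of_eq ?_ (opCost_ge_lin _ _ _ 46 19 (by norm_num))
    simp [BinOp.eval, bitsToNat_encodeNat]
  | shl =>
    refine (runs_shlW wregs hT (encodeNat a) b).of_eq ?_ (opCost_ge_shift _ _ _ W (by omega))
    simp [BinOp.eval, bitsToNat_encodeNat]
  | shr =>
    refine (runs_shrW wregs hT (encodeNat a) b).of_eq ?_
      (le_trans (by omega) (opCost_ge_shift W _ _ (encodeNat a).length (by omega)))
    simp [BinOp.eval, bitsToNat_encodeNat]
  | lt =>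
    refine (runs_ltW ρ.regs (encodeNat a) (encodeNat b)).of_eq ?_
      (le_trans (by omega) (opCost_ge_lin W _ _ 18 17 (by norm_num)))
    simp [BinOp.eval, bitsToNat_encodeNat]
  | eq =>
    refine (runs_eqW ρ.regs a b).of_eq ?_ (le_trans (by omega) (opCost_ge_lin W _ _ 7 12 (by norm_num)))
    simp [BinOp.eval]

/-! ### Loading a numeral -/

section Generic

variable {ι : Type} [DecidableEq ι]

/-- `pushNum k l`: push the bit string `l` onto `k` so that it reads `l ++ k`. [folklore] -/
def pushNum (k : ι) : List Bool → Com ι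
  | [] => skip
  | b :: l => pushNum k l ;; push k b

/-- Effect of `pushNum`, in `|l|` steps. [folklore] -/
theorem runs_pushNum (k : ι) : ∀ (l : List Bool) (R : Regs ι),
    Runs (pushNum k l) R (Function.update R k (l ++ R k)) l.length
  | [], R => (Runs.skip R).of_eq (by simp) (by simp)
  | b :: l, R => by
    have h1 := runs_pushNum k l R
    have h2 := Runs.push k b (Function.update R k (l ++ R k))
    refine (h1.seq h2).of_eq ?_ (by simp)
    simp

end Generic

/-! ### Reading and writing operands

Multi-step routines are written *left-nested* (`((a ;; b) ;; c) ;; d`), so that their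
specifications are assembled left to right by `Runs.seq`, normalising the register file to the
form `state ρ F` between steps. -/

/-- A state whose `key` and `val` are empty is unchanged by resetting them. [folklore] -/
theorem St.reset_key_val (ρ : St) (hk : ρ.key = []) (hv : ρ.val = []) : { ρ with key := [], val := [] } = ρ := by
  cases ρ; simp only at hk hv; simp [hk, hv]

/-- `loadTo dst o`: put the numeral of the value of the operand `o` on the (empty) register `dst`
(a bank register): an immediate is pushed; a direct operand is one `memRead`; an indirect operand
two. [folklore] -/
def loadTo (dst : K ⊕ AReg) : Operand → Com (K ⊕ AReg)
  | .imm c => pushNum dst (encodeNat c)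
  | .dir a => ((pushNum (Sum.inl K.key) (encodeNat a) ;; memRead) ;; clear (Sum.inl K.key)) ;;
      move (Sum.inl K.val) dst (Sum.inl K.tmp)
  | .ind a => (((((pushNum (Sum.inl K.key) (encodeNat a) ;; memRead) ;; clear (Sum.inl K.key)) ;;
      move (Sum.inl K.val) (Sum.inl K.key) (Sum.inl K.tmp)) ;; memRead) ;; clear (Sum.inl K.key)) ;;
      move (Sum.inl K.val) dst (Sum.inl K.tmp)

/-- The cost of a load: two scans of the log plus bookkeeping. [folklore] -/
def loadCost (L β : ℕ) : ℕ := 2 * (L * (3 * β + 17) + 9) + 17 * β + 6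

/-- **Loading** into an empty bank register `dst`: `dst := encodeNat (o.read mem)`,
everything else unchanged, for a log bounded by `β` representing `mem` and an operand constant
of at most `β` bits. [folklore] -/
theorem runs_loadTo {ρ : St} {W : ℕ} {E : List (List Bool × List Bool)} (h : IClean ρ W E) {mem : ℕ → ℕ}
    (hrep : Represents E mem) {β : ℕ} (hE : BoundedLog β E) (o : Operand) (ho : (encodeNat o.const).length ≤ β)
    (dst : AReg) (F : Regs AReg) (hF : F dst = []) :
    Runs (loadTo (Sum.inr dst) o) (state ρ F)
      (state ρ (Function.update F dst (encodeNat (o.read mem)))) (loadCost (encLog E).length β) := by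
  unfold loadCost
  have lrd : ∀ b, (encodeNat (mem b)).length ≤ β := fun b => by
    have := hE.length_logLookup_le (encodeNat b); rwa [hrep.lookup b] at this
  cases o with
  | imm c =>
    have h1 := runs_pushNum (Sum.inr dst : K ⊕ AReg) (encodeNat c) (state ρ F)
    simp only [state, Sum.elim_inr, hF, List.append_nil, Sum.update_elim_inr] at h1
    refine h1.of_eq rfl ?_
    simp only [Operand.const] at ho
    nlinarith [ho]
  | dir a =>
    simp only [Operand.const] at ho
    have h1 := runs_pushNum (Sum.inl K.key : K ⊕ AReg) (encodeNat a) (state ρ F)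
    simp only [state, Sum.elim_inl, regs_key, h.key, List.append_nil, Sum.update_elim_inl, update_regs_key] at h1
    have h2 := h1.seq (runs_memRead _ _ E (encodeNat a) (by simp [h.mem]) rfl (by simp [h.mem2]) (by simp [h.key2])
      (by simp [h.val]) (by simp [h.st1]) (by simp [h.st2]) (by simp [h.ph]) (by simp [h.eqf]) (by simp [h.found]))
    have h3 := (h2.seq (runs_clear (Sum.inl K.key : K ⊕ AReg) _)).seq
      (runs_move (a := (Sum.inl K.val : K ⊕ AReg)) (b := Sum.inr dst) (t := Sum.inl K.tmp)
        (by simp) (by simp) (by simp) _ (by simp [state, h.tmp]))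
    simp only [state, Sum.elim_inl, regs_key, Sum.update_elim_inl, update_regs_key, regs_val, Sum.elim_inr,
      List.append_nil, Sum.update_elim_inr, update_regs_val, hrep.lookup a, hF] at h3
    refine h3.of_eq ?_ ?_
    · simp only [state, Operand.read, St.reset_key_val ρ h.key h.val]
    · have l1 := lrd a
      nlinarith [l1, ho]
  | ind a =>
    simp only [Operand.const] at ho
    have h1 := runs_pushNum (Sum.inl K.key : K ⊕ AReg) (encodeNat a) (state ρ F)
    simp only [state, Sum.elim_inl, regs_key, h.key, List.append_nil, Sum.update_elim_inl, update_regs_key] at h1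
    have h2 := h1.seq (runs_memRead _ _ E (encodeNat a) (by simp [h.mem]) rfl (by simp [h.mem2]) (by simp [h.key2])
      (by simp [h.val]) (by simp [h.st1]) (by simp [h.st2]) (by simp [h.ph]) (by simp [h.eqf]) (by simp [h.found]))
    have h3 := (h2.seq (runs_clear (Sum.inl K.key : K ⊕ AReg) _)).seq
      (runs_move (a := (Sum.inl K.val : K ⊕ AReg)) (b := Sum.inl K.key) (t := Sum.inl K.tmp)
        (by simp) (by simp) (by simp) _ (by simp [state, h.tmp]))
    simp only [state, Sum.elim_inl, regs_key, Sum.update_elim_inl, update_regs_key, regs_val,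
      List.append_nil, update_regs_val, hrep.lookup a] at h3
    -- second read, at the address `mem a`
    have h4 := h3.seq (runs_memRead _ _ E (encodeNat (mem a)) (by simp [h.mem]) rfl (by simp [h.mem2])
      (by simp [h.key2]) (by simp) (by simp [h.st1]) (by simp [h.st2]) (by simp [h.ph]) (by simp [h.eqf])
      (by simp [h.found]))
    have h5 := (h4.seq (runs_clear (Sum.inl K.key : K ⊕ AReg) _)).seq
      (runs_move (a := (Sum.inl K.val : K ⊕ AReg)) (b := Sum.inr dst) (t := Sum.inl K.tmp)
        (by simp) (by simp) (by simp) _ (by simp [state, h.tmp]))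
    simp only [state, Sum.elim_inl, regs_key, Sum.update_elim_inl, update_regs_key, regs_val, Sum.elim_inr,
      List.append_nil, Sum.update_elim_inr, update_regs_val, hrep.lookup (mem a), hF] at h5
    refine h5.of_eq ?_ ?_
    · simp only [state, Operand.read, St.reset_key_val ρ h.key h.val]
    · have l1 := lrd a
      have l2 := lrd (mem a)
      nlinarith [l1, l2, ho]

/-- `storeDst o`: write the numeral held in `x` through the operand `o` (nothing for an
immediate; one `memWrite` for a direct operand; a `memRead` of the address then a `memWrite` for
an indirect one); `x` ends empty. [folklore] -/
def storeDst : Operand → Com (K ⊕ AReg)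
  | .imm _ => clear (Sum.inr AReg.x)
  | .dir a => pushNum (Sum.inl K.key) (encodeNat a) ;; memWrite
  | .ind a => (((pushNum (Sum.inl K.key) (encodeNat a) ;; memRead) ;; clear (Sum.inl K.key)) ;;
      move (Sum.inl K.val) (Sum.inl K.key) (Sum.inl K.tmp)) ;; memWrite

/-- The log entries prepended by `storeDst`. [folklore] -/
def storeEntries (mem : ℕ → ℕ) (v : ℕ) : Operand → List (List Bool × List Bool)
  | .imm _ => []
  | .dir a => [(encodeNat a, encodeNat v)]
  | .ind a => [(encodeNat (mem a), encodeNat v)]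

/-- **The new log represents `Operand.write`.** [folklore] -/
theorem represents_storeEntries {E : List (List Bool × List Bool)} {mem : ℕ → ℕ} (hrep : Represents E mem)
    (v : ℕ) (o : Operand) : Represents (storeEntries mem v o ++ E) (o.write mem v) := by
  cases o with
  | imm c => simpa [storeEntries, Operand.write] using hrep
  | dir a => simpa [storeEntries, Operand.write] using hrep.update a v
  | ind a => simpa [storeEntries, Operand.write] using hrep.update (mem a) v

/-- At most one entry is written. [folklore] -/
theorem length_storeEntries_le (mem : ℕ → ℕ) (v : ℕ) (o : Operand) : (storeEntries mem v o).length ≤ 1 := by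
  cases o <;> simp [storeEntries]

/-- The written entry is bounded when the address and the value are. [folklore] -/
theorem boundedLog_storeEntries {β : ℕ} {E : List (List Bool × List Bool)} (hE : BoundedLog β E) {mem : ℕ → ℕ}
    (hmem : ∀ b, (encodeNat (mem b)).length ≤ β) {v : ℕ} (hv : (encodeNat v).length ≤ β) (o : Operand)
    (ho : (encodeNat o.const).length ≤ β) : BoundedLog β (storeEntries mem v o ++ E) := by
  cases o with
  | imm c => simpa [storeEntries] using hE
  | dir a => exact hE.cons ho hv
  | ind a => exact hE.cons (hmem a) hv

/-- The cost of a store: one scan of the log plus bookkeeping. [folklore] -/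
def storeCost (L β : ℕ) : ℕ := L * (3 * β + 17) + 9 + 23 * β + 10

/-- **Storing** the numeral of `v` held in `x` through `o`: the log gains `storeEntries`, `x` is
emptied. [folklore] -/
theorem runs_storeDst {ρ : St} {W : ℕ} {E : List (List Bool × List Bool)} (h : IClean ρ W E) {mem : ℕ → ℕ}
    (hrep : Represents E mem) {β : ℕ} (hE : BoundedLog β E) (o : Operand) (ho : (encodeNat o.const).length ≤ β)
    (v : ℕ) (hv : (encodeNat v).length ≤ β) (y : List Bool) :
    Runs (storeDst o) (state ρ (AReg.file (encodeNat v) y [] [] [] [] [] []))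
      (state { ρ with mem := encLog (storeEntries mem v o ++ E) } (AReg.file [] y [] [] [] [] [] []))
      (storeCost (encLog E).length β) := by
  unfold storeCost
  have lrd : ∀ b, (encodeNat (mem b)).length ≤ β := fun b => by
    have := hE.length_logLookup_le (encodeNat b); rwa [hrep.lookup b] at this
  cases o with
  | imm c =>
    have h1 := runs_clear (Sum.inr AReg.x : K ⊕ AReg) (state ρ (AReg.file (encodeNat v) y [] [] [] [] [] []))
    simp only [state, Sum.elim_inr, AReg.file_x, Sum.update_elim_inr, AReg.update_file_x] at h1
    refine h1.of_eq ?_ (by nlinarith [hv])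
    simp only [state, storeEntries, List.nil_append]
    congr 2
    cases ρ; have := h.mem; simp only at this; simp [this]
  | dir a =>
    simp only [Operand.const] at ho
    have h1 := runs_pushNum (Sum.inl K.key : K ⊕ AReg) (encodeNat a) (state ρ (AReg.file (encodeNat v) y [] [] [] [] [] []))
    simp only [state, Sum.elim_inl, regs_key, h.key, List.append_nil, Sum.update_elim_inl, update_regs_key] at h1
    have h2 := h1.seq (runs_memWrite _ E (encodeNat a) (encodeNat v) y [] [] [] [] [] [] (by simp [h.mem]) rfl
      (by simp [h.key2]))
    refine h2.of_eq ?_ (by nlinarith [hv, ho])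
    simp only [state, storeEntries, List.singleton_append]
    congr 2
    cases ρ; have h1' := h.key; have h2' := h.key2; simp only at h1' h2'; simp [h1', h2']
  | ind a =>
    simp only [Operand.const] at ho
    have h1 := runs_pushNum (Sum.inl K.key : K ⊕ AReg) (encodeNat a) (state ρ (AReg.file (encodeNat v) y [] [] [] [] [] []))
    simp only [state, Sum.elim_inl, regs_key, h.key, List.append_nil, Sum.update_elim_inl, update_regs_key] at h1
    have h2 := h1.seq (runs_memRead _ _ E (encodeNat a) (by simp [h.mem]) rfl (by simp [h.mem2]) (by simp [h.key2])
      (by simp [h.val]) (by simp [h.st1]) (by simp [h.st2]) (by simp [h.ph]) (by simp [h.eqf]) (by simp [h.found]))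
    have h3 := (h2.seq (runs_clear (Sum.inl K.key : K ⊕ AReg) _)).seq
      (runs_move (a := (Sum.inl K.val : K ⊕ AReg)) (b := Sum.inl K.key) (t := Sum.inl K.tmp)
        (by simp) (by simp) (by simp) _ (by simp [state, h.tmp]))
    simp only [state, Sum.elim_inl, regs_key, Sum.update_elim_inl, update_regs_key, regs_val,
      List.append_nil, update_regs_val, hrep.lookup a] at h3
    have h4 := h3.seq (runs_memWrite _ E (encodeNat (mem a)) (encodeNat v) y [] [] [] [] [] [] (by simp [h.mem]) rfl
      (by simp [h.key2]))
    refine h4.of_eq ?_ ?_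
    · simp only [state, storeEntries, List.singleton_append]
      congr 2
      cases ρ; have h1' := h.key; have h2' := h.key2; have h3' := h.val; simp only at h1' h2' h3'
      simp [h1', h2', h3']
    · have l1 := lrd a
      nlinarith [l1, hv, ho]

/-! ### Configurations as register files -/

/-- The empty arithmetic bank. [folklore] -/
abbrev F0 : Regs AReg := AReg.file [] [] [] [] [] [] [] []

/-- The program counter in unary; a halted machine has an empty counter. [folklore] -/
def pcEnc : Option ℕ → List Bool
  | none => []
  | some i => ones i

/-- `pcEnc` of a running counter. [folklore] -/
@[simp] theorem pcEnc_some (i : ℕ) : pcEnc (some i) = ones i := rfl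

/-- `pcEnc` of a halted counter. [folklore] -/
@[simp] theorem pcEnc_none : pcEnc none = [] := rfl

/-- The main register file encoding a configuration between two steps: the log, the ruler, the
program counter, the run flag; everything else empty. [folklore] -/
def cfgSt (W : ℕ) (E : List (List Bool × List Bool)) (pc : Option ℕ) (run : List Bool) : St :=
  { St.zero with mem := encLog E, wr := ones W, pc := pcEnc pc, run := run }

/-- A configuration file is clean. [folklore] -/
theorem iclean_cfgSt (W : ℕ) (E : List (List Bool × List Bool)) (pc : Option ℕ) (run : List Bool) :
    IClean (cfgSt W E pc run) W E :=
  ⟨rfl, rfl, rfl, rfl, rfl, rfl, rfl, rfl, rfl, rfl, rfl, rfl, rfl, rfl, rfl, rfl, rfl⟩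

/-- Replacing the log of a configuration file. [folklore] -/
@[simp] theorem cfgSt_with_mem (W : ℕ) (E E' : List (List Bool × List Bool)) (pc : Option ℕ) (run : List Bool) :
    ({ cfgSt W E pc run with mem := encLog E' } : St) = cfgSt W E' pc run := rfl

/-- Fields of a configuration file. [folklore] -/
@[simp] theorem cfgSt_mem (W : ℕ) (E : List (List Bool × List Bool)) (pc : Option ℕ) (run : List Bool) :
    (cfgSt W E pc run).mem = encLog E := rfl

/-- Fields of a configuration file. [folklore] -/
@[simp] theorem cfgSt_pc (W : ℕ) (E : List (List Bool × List Bool)) (pc : Option ℕ) (run : List Bool) :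
    (cfgSt W E pc run).pc = pcEnc pc := rfl

/-- Fields of a configuration file. [folklore] -/
@[simp] theorem cfgSt_mem2 (W : ℕ) (E : List (List Bool × List Bool)) (pc : Option ℕ) (run : List Bool) :
    (cfgSt W E pc run).mem2 = [] := rfl

/-- Fields of a configuration file. [folklore] -/
@[simp] theorem cfgSt_key (W : ℕ) (E : List (List Bool × List Bool)) (pc : Option ℕ) (run : List Bool) :
    (cfgSt W E pc run).key = [] := rfl

/-- Fields of a configuration file. [folklore] -/
@[simp] theorem cfgSt_key2 (W : ℕ) (E : List (List Bool × List Bool)) (pc : Option ℕ) (run : List Bool) :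
    (cfgSt W E pc run).key2 = [] := rfl

/-- Fields of a configuration file. [folklore] -/
@[simp] theorem cfgSt_val (W : ℕ) (E : List (List Bool × List Bool)) (pc : Option ℕ) (run : List Bool) :
    (cfgSt W E pc run).val = [] := rfl

/-- Fields of a configuration file. [folklore] -/
@[simp] theorem cfgSt_st1 (W : ℕ) (E : List (List Bool × List Bool)) (pc : Option ℕ) (run : List Bool) :
    (cfgSt W E pc run).st1 = [] := rfl

/-- Fields of a configuration file. [folklore] -/
@[simp] theorem cfgSt_st2 (W : ℕ) (E : List (List Bool × List Bool)) (pc : Option ℕ) (run : List Bool) :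
    (cfgSt W E pc run).st2 = [] := rfl

/-- Fields of a configuration file. [folklore] -/
@[simp] theorem cfgSt_ph (W : ℕ) (E : List (List Bool × List Bool)) (pc : Option ℕ) (run : List Bool) :
    (cfgSt W E pc run).ph = [] := rfl

/-- Fields of a configuration file. [folklore] -/
@[simp] theorem cfgSt_eqf (W : ℕ) (E : List (List Bool × List Bool)) (pc : Option ℕ) (run : List Bool) :
    (cfgSt W E pc run).eqf = [] := rfl

/-- Fields of a configuration file. [folklore] -/
@[simp] theorem cfgSt_found (W : ℕ) (E : List (List Bool × List Bool)) (pc : Option ℕ) (run : List Bool) :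
    (cfgSt W E pc run).found = [] := rfl

/-- Fields of a configuration file. [folklore] -/
@[simp] theorem cfgSt_cn (W : ℕ) (E : List (List Bool × List Bool)) (pc : Option ℕ) (run : List Bool) :
    (cfgSt W E pc run).cn = [] := rfl

/-- Fields of a configuration file. [folklore] -/
@[simp] theorem cfgSt_cn2 (W : ℕ) (E : List (List Bool × List Bool)) (pc : Option ℕ) (run : List Bool) :
    (cfgSt W E pc run).cn2 = [] := rfl

/-- Fields of a configuration file. [folklore] -/
@[simp] theorem cfgSt_msb (W : ℕ) (E : List (List Bool × List Bool)) (pc : Option ℕ) (run : List Bool) :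
    (cfgSt W E pc run).msb = [] := rfl

/-- Fields of a configuration file. [folklore] -/
@[simp] theorem cfgSt_quo (W : ℕ) (E : List (List Bool × List Bool)) (pc : Option ℕ) (run : List Bool) :
    (cfgSt W E pc run).quo = [] := rfl

/-- Fields of a configuration file. [folklore] -/
@[simp] theorem cfgSt_scr (W : ℕ) (E : List (List Bool × List Bool)) (pc : Option ℕ) (run : List Bool) :
    (cfgSt W E pc run).scr = [] := rfl

/-- Fields of a configuration file. [folklore] -/
@[simp] theorem cfgSt_tmp (W : ℕ) (E : List (List Bool × List Bool)) (pc : Option ℕ) (run : List Bool) :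
    (cfgSt W E pc run).tmp = [] := rfl

/-- Fields of a configuration file. [folklore] -/
@[simp] theorem cfgSt_inp (W : ℕ) (E : List (List Bool × List Bool)) (pc : Option ℕ) (run : List Bool) :
    (cfgSt W E pc run).inp = [] := rfl

/-- Fields of a configuration file. [folklore] -/
@[simp] theorem cfgSt_nrev (W : ℕ) (E : List (List Bool × List Bool)) (pc : Option ℕ) (run : List Bool) :
    (cfgSt W E pc run).nrev = [] := rfl

/-- Fields of a configuration file. [folklore] -/
@[simp] theorem cfgSt_nrev2 (W : ℕ) (E : List (List Bool × List Bool)) (pc : Option ℕ) (run : List Bool) :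
    (cfgSt W E pc run).nrev2 = [] := rfl

/-- Fields of a configuration file. [folklore] -/
@[simp] theorem cfgSt_nb (W : ℕ) (E : List (List Bool × List Bool)) (pc : Option ℕ) (run : List Bool) :
    (cfgSt W E pc run).nb = [] := rfl

/-- Fields of a configuration file. [folklore] -/
@[simp] theorem cfgSt_un (W : ℕ) (E : List (List Bool × List Bool)) (pc : Option ℕ) (run : List Bool) :
    (cfgSt W E pc run).un = [] := rfl

/-- Fields of a configuration file. [folklore] -/
@[simp] theorem cfgSt_tokc (W : ℕ) (E : List (List Bool × List Bool)) (pc : Option ℕ) (run : List Bool) :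
    (cfgSt W E pc run).tokc = [] := rfl

/-- Fields of a configuration file. [folklore] -/
@[simp] theorem cfgSt_adr (W : ℕ) (E : List (List Bool × List Bool)) (pc : Option ℕ) (run : List Bool) :
    (cfgSt W E pc run).adr = [] := rfl

/-- Fields of a configuration file. [folklore] -/
@[simp] theorem cfgSt_a0 (W : ℕ) (E : List (List Bool × List Bool)) (pc : Option ℕ) (run : List Bool) :
    (cfgSt W E pc run).a0 = [] := rfl

/-- Fields of a configuration file. [folklore] -/
@[simp] theorem cfgSt_cl (W : ℕ) (E : List (List Bool × List Bool)) (pc : Option ℕ) (run : List Bool) :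
    (cfgSt W E pc run).cl = [] := rfl

/-- Fields of a configuration file. [folklore] -/
@[simp] theorem cfgSt_mc (W : ℕ) (E : List (List Bool × List Bool)) (pc : Option ℕ) (run : List Bool) :
    (cfgSt W E pc run).mc = [] := rfl

/-- Fields of a configuration file. [folklore] -/
@[simp] theorem cfgSt_lit (W : ℕ) (E : List (List Bool × List Bool)) (pc : Option ℕ) (run : List Bool) :
    (cfgSt W E pc run).lit = [] := rfl

/-- Fields of a configuration file. [folklore] -/
@[simp] theorem cfgSt_he (W : ℕ) (E : List (List Bool × List Bool)) (pc : Option ℕ) (run : List Bool) :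
    (cfgSt W E pc run).he = [] := rfl

/-- Fields of a configuration file. [folklore] -/
@[simp] theorem cfgSt_incl (W : ℕ) (E : List (List Bool × List Bool)) (pc : Option ℕ) (run : List Bool) :
    (cfgSt W E pc run).incl = [] := rfl

/-- Fields of a configuration file. [folklore] -/
@[simp] theorem cfgSt_it1 (W : ℕ) (E : List (List Bool × List Bool)) (pc : Option ℕ) (run : List Bool) :
    (cfgSt W E pc run).it1 = [] := rfl

/-- Fields of a configuration file. [folklore] -/
@[simp] theorem cfgSt_it2 (W : ℕ) (E : List (List Bool × List Bool)) (pc : Option ℕ) (run : List Bool) :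
    (cfgSt W E pc run).it2 = [] := rfl

/-- Fields of a configuration file. [folklore] -/
@[simp] theorem cfgSt_ifl (W : ℕ) (E : List (List Bool × List Bool)) (pc : Option ℕ) (run : List Bool) :
    (cfgSt W E pc run).ifl = [] := rfl

/-- Fields of a configuration file. [folklore] -/
@[simp] theorem cfgSt_out (W : ℕ) (E : List (List Bool × List Bool)) (pc : Option ℕ) (run : List Bool) :
    (cfgSt W E pc run).out = [] := rfl

/-- Fields of a configuration file. [folklore] -/
@[simp] theorem cfgSt_run (W : ℕ) (E : List (List Bool × List Bool)) (pc : Option ℕ) (run : List Bool) :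
    (cfgSt W E pc run).run = run := rfl

/-! ### The code of an instruction -/

/-- Set the (empty) program counter to `t` and re-arm the run flag. [folklore] -/
def next (t : ℕ) : Com (K ⊕ AReg) := pushK (Sum.inl K.pc) t ;; push (Sum.inl K.run) true

/-- Effect of `next` on a halted-looking configuration file. [folklore] -/
theorem runs_next (W : ℕ) (E : List (List Bool × List Bool)) (t : ℕ) :
    Runs (next t) (state (cfgSt W E none []) F0) (state (cfgSt W E (some t) [true]) F0) (t + 1) := by
  have h1 := runs_pushK (Sum.inl K.pc : K ⊕ AReg) t (state (cfgSt W E none []) F0)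
  have h2 := h1.seq (Runs.push (Sum.inl K.run) true _)
  simp only [state, Sum.elim_inl, regs_pc, cfgSt_pc, pcEnc_none, List.append_nil, Sum.update_elim_inl,
    update_regs_pc, regs_run, cfgSt_run, update_regs_run] at h2
  exact h2.of_eq rfl le_rfl

/-- The code of the instruction at position `i`. [folklore] -/
def instrCode (i : ℕ) : Instr → Com (K ⊕ AReg)
  | .op o dst x y => (((loadTo (Sum.inr AReg.x) x ;; loadTo (Sum.inr AReg.y) y) ;; opW o) ;; storeDst dst) ;; next (i + 1)
  | .jmp t => next t
  | .jz x t => loadTo (Sum.inr AReg.x) x ;;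
      pop (Sum.inr AReg.x) (clear (Sum.inr AReg.x) ;; next (i + 1)) (clear (Sum.inr AReg.x) ;; next (i + 1)) (next t)
  | .rand dst => storeDst dst ;; next (i + 1)
  | .query _ _ aa => ((loadTo (Sum.inr AReg.x) aa ;; move (Sum.inr AReg.x) (Sum.inl K.key) (Sum.inl K.tmp)) ;;
      memWrite) ;; next (i + 1)
  | .halt => skip

/-- The jump target of an instruction (`0` if none). [folklore] -/
def jumpTarget : Instr → ℕ
  | .jmp t => t
  | .jz _ t => t
  | _ => 0

/-- A bound for all program-counter values of a run: the length of the program plus its largest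
jump target. [folklore] -/
def pcBound (M : Program) : ℕ := M.length + (M.map jumpTarget).foldr max 0

/-- Jump targets are below `pcBound`. [folklore] -/
theorem jumpTarget_le_pcBound {M : Program} {I : Instr} (h : I ∈ M) : jumpTarget I ≤ pcBound M := by
  unfold pcBound
  suffices jumpTarget I ≤ (M.map jumpTarget).foldr max 0 by omega
  induction M with
  | nil => simp at h
  | cons J M ih =>
    rw [List.map_cons, List.foldr_cons]
    rcases List.mem_cons.1 h with rfl | h'
    · exact le_max_left _ _
    · exact le_trans (ih h') (le_max_right _ _)

/-- The cost of one instruction on a log of code length `L`. [folklore] -/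
def instrCost (L W β P : ℕ) : ℕ := 2 * loadCost L β + opCost W β β + storeCost L β + P + 16 * β + 16

/-- `opCost` is monotone in the operand lengths. [folklore] -/
theorem opCost_mono (W : ℕ) {la lb β : ℕ} (ha : la ≤ β) (hb : lb ≤ β) : opCost W la lb ≤ opCost W β β := by
  unfold opCost
  exact Nat.mul_le_mul_left _ (Nat.pow_le_pow_left (by omega) 2)

/-! ### One instruction -/

/-- **Simulation of one instruction.** From the configuration file of `⟨some j, mem, …⟩` with the
program counter already consumed by the dispatch, the code of the instruction `M[j] = I` leads to
the configuration file of `step … = some cfg'` (new log in front of the old one, program counter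
and run flag re-armed unless the machine halted), within `instrCost`. The bounds: the log is
`β`-bounded and represents a `V`-bounded memory, `V ≥ 2^W - 1, maxConst M, 1`, and numerals of
numbers `≤ V` have at most `β` bits. [folklore] -/
theorem runs_instrCode {M : Program} {W : ℕ} {E : List (List Bool × List Bool)} {mem : ℕ → ℕ} {β V : ℕ}
    (hrep : Represents E mem) (hE : BoundedLog β E) (hV : MemLE V mem) (hwV : 2 ^ W - 1 ≤ V) (h1V : 1 ≤ V)
    (hMV : Program.maxConst M ≤ V) (hβ : (encodeNat V).length ≤ β)
    {j : ℕ} {I : Instr} (hI : M[j]? = some I) {cp : ℕ} {qs : List (List ℕ)} {cfg' : Cfg}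
    (hs : step M W noOracle zeroCoins ⟨some j, mem, cp, qs⟩ = some cfg') :
    ∃ E', Represents E' cfg'.mem ∧ BoundedLog β E' ∧ E'.length ≤ E.length + 1 ∧
      Runs (instrCode j I) (state (cfgSt W E none []) F0)
        (state (cfgSt W E' cfg'.pc (flag cfg'.pc.isSome)) F0) (instrCost (encLog E).length W β (pcBound M)) := by
  have hIc : I.maxConst ≤ V := le_trans (Instr.maxConst_le_of_getElem? hI) hMV
  have hlenV : ∀ {v}, v ≤ V → (encodeNat v).length ≤ β := fun hv => le_trans (Brick.length_encodeNat_mono hv) hβ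
  have hjM : j < M.length := (List.getElem?_eq_some_iff.1 hI).1
  have hj1 : j + 1 ≤ pcBound M := by unfold pcBound; omega
  have hclean := iclean_cfgSt W E none []
  have hmemβ : ∀ b, (encodeNat (mem b)).length ≤ β := fun b => hlenV (hV b)
  unfold step at hs
  simp only [hI] at hs
  unfold instrCost
  cases I with
  | halt =>
    simp only [Option.some.injEq] at hs
    subst hs
    refine ⟨E, hrep, hE, by omega, ?_⟩
    exact (Runs.skip _).of_eq (by simp [flag]) (by omega)
  | jmp t =>
    simp only [Option.some.injEq] at hs
    subst hs
    have ht : t ≤ pcBound M := jumpTarget_le_pcBound (List.mem_of_getElem? hI)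
    refine ⟨E, hrep, hE, by omega, ?_⟩
    exact (runs_next W E t).of_eq (by simp [flag]) (by omega)
  | op o dst x y =>
    simp only [Option.some.injEq] at hs
    subst hs
    simp only [Instr.maxConst, max_le_iff] at hIc
    set a := x.read mem
    set b := y.read mem
    set v := o.eval W a b
    have hva : a ≤ V := Operand.read_le hV x hIc.2.1
    have hvb : b ≤ V := Operand.read_le hV y hIc.2.2
    have hvv : v ≤ V := BinOp.eval_le hva hwV h1V o
    have h1 := runs_loadTo hclean hrep hE x (hlenV hIc.2.1) AReg.x F0 rfl
    have h2 := h1.seq (runs_loadTo hclean hrep hE y (hlenV hIc.2.2) AReg.y _ (by simp))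
    simp only [AReg.update_file_x, AReg.update_file_y] at h2
    have h3 := h2.seq (runs_opW hclean o a b)
    have h4 := h3.seq (runs_storeDst hclean hrep hE dst (hlenV hIc.1) v (hlenV hvv) [])
    simp only [cfgSt_with_mem] at h4
    have h5 := h4.seq (runs_next W (storeEntries mem v dst ++ E) (j + 1))
    refine ⟨storeEntries mem v dst ++ E, represents_storeEntries hrep v dst,
      boundedLog_storeEntries hE hmemβ (hlenV hvv) dst (hlenV hIc.1), ?_, ?_⟩
    · have := length_storeEntries_le mem v dst; simp; omega
    · refine h5.of_eq (by simp [flag]) ?_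
      have := opCost_mono W (hlenV hva) (hlenV hvb)
      omega
  | jz x t =>
    simp only [Option.some.injEq] at hs
    subst hs
    simp only [Instr.maxConst] at hIc
    have ht : t ≤ pcBound M := jumpTarget_le_pcBound (List.mem_of_getElem? hI)
    have hva : x.read mem ≤ V := Operand.read_le hV x hIc
    refine ⟨E, hrep, hE, by omega, ?_⟩
    have h1 := runs_loadTo hclean hrep hE x (hlenV hIc) AReg.x F0 rfl
    simp only [AReg.update_file_x] at h1
    by_cases h0 : x.read mem = 0
    · rw [h0, if_pos rfl]
      rw [h0, show encodeNat 0 = [] by decide] at h1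
      have hk : state (cfgSt W E none []) (AReg.file [] [] [] [] [] [] [] []) (Sum.inr AReg.x) = [] := by
        simp [state]
      have h2 := h1.seq (Runs.pop_nil (clear (Sum.inr AReg.x) ;; next (j + 1)) (clear (Sum.inr AReg.x) ;; next (j + 1))
        hk (runs_next W E t))
      exact h2.of_eq (by simp [flag]) (by unfold loadCost; omega)
    · rw [if_neg h0]
      rcases hx : encodeNat (x.read mem) with _ | ⟨bit, rest⟩
      · exact absurd (eq_zero_of_encodeNat_eq_nil hx) h0
      rw [hx] at h1
      have hlen : rest.length ≤ β := by
        have := hlenV hva; rw [hx] at this; simp at this; omega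
      have hbr : Runs (clear (Sum.inr AReg.x) ;; next (j + 1)) (state (cfgSt W E none []) (AReg.file rest [] [] [] [] [] [] []))
          (state (cfgSt W E (some (j + 1)) [true]) F0) (2 * rest.length + 1 + (j + 1 + 1)) := by
        have c1 := runs_clear (Sum.inr AReg.x : K ⊕ AReg) (state (cfgSt W E none []) (AReg.file rest [] [] [] [] [] [] []))
        simp only [state, Sum.elim_inr, AReg.file_x, Sum.update_elim_inr, AReg.update_file_x] at c1
        exact c1.seq (runs_next W E (j + 1))
      have hk : state (cfgSt W E none []) (AReg.file (bit :: rest) [] [] [] [] [] [] []) (Sum.inr AReg.x) = bit :: rest := by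
        simp [state]
      have hupd : Function.update (state (cfgSt W E none []) (AReg.file (bit :: rest) [] [] [] [] [] [] []))
          (Sum.inr AReg.x) rest = state (cfgSt W E none []) (AReg.file rest [] [] [] [] [] [] []) := by
        simp [state]
      cases bit
      · exact (h1.seq (Runs.pop_false' _ _ hk hupd hbr)).of_eq (by simp [flag]) (by unfold loadCost; omega)
      · exact (h1.seq (Runs.pop_true' _ _ hk hupd hbr)).of_eq (by simp [flag]) (by unfold loadCost; omega)
  | rand dst =>
    simp only [Option.some.injEq] at hs
    subst hs
    simp only [Instr.maxConst] at hIc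
    simp only [zeroCoins_apply, Nat.zero_mod]
    have e0 : encodeNat 0 = [] := by decide
    have h1 := runs_storeDst hclean hrep hE dst (hlenV hIc) 0 (by rw [e0]; simp) []
    rw [e0] at h1
    simp only [cfgSt_with_mem] at h1
    have h2 := h1.seq (runs_next W (storeEntries mem 0 dst ++ E) (j + 1))
    refine ⟨storeEntries mem 0 dst ++ E, represents_storeEntries hrep 0 dst,
      boundedLog_storeEntries hE hmemβ (by rw [e0]; simp) dst (hlenV hIc), ?_, ?_⟩
    · have := length_storeEntries_le mem 0 dst; simp; omega
    · exact h2.of_eq (by simp [flag]) (by omega)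
  | query qa ql aa =>
    simp only [noOracle_apply, List.map_nil, List.length_nil, writeSeg_nil, Option.some.injEq] at hs
    subst hs
    simp only [Instr.maxConst, max_le_iff] at hIc
    have had : aa.read mem ≤ V := Operand.read_le hV aa hIc.2.2
    have e0 : encodeNat 0 = [] := by decide
    have h1 := runs_loadTo hclean hrep hE aa (hlenV hIc.2.2) AReg.x F0 rfl
    simp only [AReg.update_file_x] at h1
    have h2 := h1.seq (runs_move (a := (Sum.inr AReg.x : K ⊕ AReg)) (b := Sum.inl K.key) (t := Sum.inl K.tmp)
      (by simp) (by simp) (by simp) _ (by simp [state, cfgSt, St.zero]))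
    simp only [state, Sum.elim_inr, AReg.file_x, Sum.elim_inl, regs_key, Sum.update_elim_inr, AReg.update_file_x,
      Sum.update_elim_inl, update_regs_key] at h2
    have hkey0 : (cfgSt W E none []).key = [] := rfl
    rw [hkey0, List.append_nil] at h2
    have h3 := h2.seq (runs_memWrite _ E (encodeNat (aa.read mem)) [] [] [] [] [] [] [] [] rfl rfl rfl)
    have h4 := h3.seq (runs_next W ((encodeNat (aa.read mem), []) :: E) (j + 1) |>.of_eq rfl le_rfl |> fun h => by
      simpa [cfgSt] using h)
    refine ⟨(encodeNat (aa.read mem), encodeNat 0) :: E, hrep.update (aa.read mem) 0,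
      hE.cons (hlenV had) (by rw [e0]; simp), by simp, ?_⟩
    refine h4.of_eq ?_ ?_
    · simp [flag, cfgSt, e0]
    · have := hlenV had
      unfold loadCost; simp only [List.length_nil]; omega

/-! ### Dispatch on the program counter -/

/-- `dispatchL rest i`: the instructions `rest` sit at positions `i, i+1, …`; pop the unary program
counter once per position until it is exhausted, then run the instruction reached; beyond the
program, clear the counter (the machine halts). [folklore] -/
def dispatchL : List Instr → ℕ → Com (K ⊕ AReg)
  | [], _ => clear (Sum.inl K.pc)
  | I :: rest, i => pop (Sum.inl K.pc) (dispatchL rest (i + 1)) (dispatchL rest (i + 1)) (instrCode i I)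

/-- The body of the interpreter loop: dispatch over the whole program. [folklore] -/
def body (M : Program) : Com (K ⊕ AReg) := dispatchL M 0

/-- The interpreter: repeat the body while the run flag is re-armed. [folklore] -/
def interp (M : Program) : Com (K ⊕ AReg) := loop (Sum.inl K.run) (body M) (body M)

/-- **Dispatch, hit.** With `1^d` on the program counter and an instruction at position `d` of
`rest`, the dispatch runs the code of that instruction (numbered `i + d`) from the file with the
counter emptied, after `2 (d + 1)` steps. [folklore] -/
theorem runs_dispatchL_hit (F : Regs AReg) : ∀ (rest : List Instr) (i d : ℕ) (ρ : St) {I : Instr}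
    {R' : Regs (K ⊕ AReg)} {B : ℕ}, ρ.pc = ones d → rest[d]? = some I →
    Runs (instrCode (i + d) I) (state { ρ with pc := [] } F) R' B → Runs (dispatchL rest i) (state ρ F) R' (B + 2 * (d + 1))
  | [], i, d, ρ, I, R', B, _, hI, _ => by simp at hI
  | J :: rest, i, 0, ρ, I, R', B, hpc, hI, h => by
    simp only [List.getElem?_cons_zero, Option.some.injEq] at hI
    subst hI
    rw [Nat.add_zero] at h
    have e : ({ ρ with pc := [] } : St) = ρ := by cases ρ; simp only at hpc; simp [hpc]
    rw [e] at h
    exact (Runs.pop_nil _ _ (by simp [state, hpc]) h).of_eq rfl (by omega)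
  | J :: rest, i, d + 1, ρ, I, R', B, hpc, hI, h => by
    simp only [List.getElem?_cons_succ] at hI
    rw [show i + (d + 1) = (i + 1) + d by omega] at h
    have ih := runs_dispatchL_hit F rest (i + 1) d { ρ with pc := ones d } rfl hI (by simpa using h)
    refine (Runs.pop_true' _ _ (w := ones d) (by simp [state, hpc, ones, List.replicate_succ]) (by simp [state]) ih).of_eq
      rfl (by omega)

/-- **Dispatch, miss.** With `1^d` on the program counter, `d` beyond `rest`, the dispatch just
empties the counter, in `2 d + 1` steps. [folklore] -/
theorem runs_dispatchL_miss (F : Regs AReg) : ∀ (rest : List Instr) (i d : ℕ) (ρ : St),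
    ρ.pc = ones d → rest.length ≤ d →
    Runs (dispatchL rest i) (state ρ F) (state { ρ with pc := [] } F) (2 * d + 1)
  | [], i, d, ρ, hpc, _ => by
    have := runs_clear (Sum.inl K.pc : K ⊕ AReg) (state ρ F)
    simp only [state, Sum.elim_inl, regs_pc, hpc, List.length_replicate, Sum.update_elim_inl, update_regs_pc] at this
    exact this
  | J :: rest, i, 0, ρ, hpc, hd => by simp at hd
  | J :: rest, i, d + 1, ρ, hpc, hd => by
    simp only [List.length_cons, Nat.succ_le_succ_iff] at hd
    have ih := runs_dispatchL_miss F rest (i + 1) d { ρ with pc := ones d } rfl hd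
    refine (Runs.pop_true' _ _ (w := ones d) (by simp [state, hpc, ones, List.replicate_succ]) (by simp [state]) ih).of_eq
      (by simp) (by omega)

/-! ### One step of the word RAM -/

/-- Program counters along a run stay below `pcBound`. [folklore] -/
theorem step_pc_le_pcBound {M : Program} {W : ℕ} {O : List ℕ → List ℕ} {ρc : ℕ → ℕ} {c c' : Cfg}
    (hs : step M W O ρc c = some c') {i : ℕ} (hi : c'.pc = some i) : i ≤ pcBound M := by
  unfold step at hs
  cases hpc : c.pc with
  | none => simp [hpc] at hs
  | some j =>
    simp only [hpc] at hs
    cases hI : M[j]? with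
    | none => simp only [hI, Option.some.injEq] at hs; subst hs; simp at hi
    | some I =>
      have hjM : j < M.length := (List.getElem?_eq_some_iff.1 hI).1
      have hIt : jumpTarget I ≤ pcBound M := jumpTarget_le_pcBound (List.mem_of_getElem? hI)
      simp only [hI] at hs
      cases I with
      | halt => simp only [Option.some.injEq] at hs; subst hs; simp at hi
      | jmp t => simp only [Option.some.injEq] at hs; subst hs; simp at hi; subst hi; simpa [jumpTarget] using hIt
      | jz x t =>
        simp only [Option.some.injEq] at hs; subst hs
        simp only at hi
        split_ifs at hi with h0
        · simp at hi; subst hi; simpa [jumpTarget] using hIt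
        · simp at hi; subst hi; unfold pcBound; omega
      | op o dst x y => simp only [Option.some.injEq] at hs; subst hs; simp at hi; subst hi; unfold pcBound; omega
      | rand dst => simp only [Option.some.injEq] at hs; subst hs; simp at hi; subst hi; unfold pcBound; omega
      | query qa ql aa => simp only [Option.some.injEq] at hs; subst hs; simp at hi; subst hi; unfold pcBound; omega

/-- **Simulation of one step of the word RAM.** From the configuration file of a running
configuration (`pc = some j`, `j ≤ pcBound M`), the body of the interpreter leads to the
configuration file of `step … = some cfg'`, within `instrCost + 2 pcBound + 3`. [folklore] -/
theorem runs_body_step {M : Program} {W : ℕ} {E : List (List Bool × List Bool)} {mem : ℕ → ℕ} {β V : ℕ}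
    (hrep : Represents E mem) (hE : BoundedLog β E) (hV : MemLE V mem) (hwV : 2 ^ W - 1 ≤ V) (h1V : 1 ≤ V)
    (hMV : Program.maxConst M ≤ V) (hβ : (encodeNat V).length ≤ β)
    {j : ℕ} (hj : j ≤ pcBound M) {cp : ℕ} {qs : List (List ℕ)} {cfg' : Cfg}
    (hs : step M W noOracle zeroCoins ⟨some j, mem, cp, qs⟩ = some cfg') :
    ∃ E', Represents E' cfg'.mem ∧ BoundedLog β E' ∧ E'.length ≤ E.length + 1 ∧
      Runs (body M) (state (cfgSt W E (some j) []) F0)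
        (state (cfgSt W E' cfg'.pc (flag cfg'.pc.isSome)) F0)
        (instrCost (encLog E).length W β (pcBound M) + 2 * pcBound M + 3) := by
  cases hI : M[j]? with
  | none =>
    have hs' := hs
    unfold step at hs'
    simp only [hI, Option.some.injEq] at hs'
    subst hs'
    refine ⟨E, hrep, hE, by omega, ?_⟩
    have hjM : M.length ≤ j := by simpa using (List.getElem?_eq_none_iff.1 hI)
    refine (runs_dispatchL_miss F0 M 0 j (cfgSt W E (some j) []) rfl hjM).of_eq ?_ (by omega)
    simp [flag, cfgSt]
  | some I =>
    obtain ⟨E', hrep', hE', hlen, hrun⟩ := runs_instrCode hrep hE hV hwV h1V hMV hβ hI hs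
    have hjM : j < M.length := (List.getElem?_eq_some_iff.1 hI).1
    refine ⟨E', hrep', hE', hlen, ?_⟩
    have := runs_dispatchL_hit F0 M 0 j (cfgSt W E (some j) []) (I := I) rfl hI
      (by rw [Nat.zero_add]; simpa [cfgSt] using hrun)
    refine this.of_eq rfl ?_
    unfold pcBound; omega

/-! ### Whole runs -/

/-- `loadCost` is monotone in the log length. [folklore] -/
theorem loadCost_mono {L L' : ℕ} (h : L ≤ L') (β : ℕ) : loadCost L β ≤ loadCost L' β := by
  unfold loadCost; have := Nat.mul_le_mul_right (3 * β + 17) h; omega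

/-- `storeCost` is monotone in the log length. [folklore] -/
theorem storeCost_mono {L L' : ℕ} (h : L ≤ L') (β : ℕ) : storeCost L β ≤ storeCost L' β := by
  unfold storeCost; have := Nat.mul_le_mul_right (3 * β + 17) h; omega

/-- `instrCost` is monotone in the log length. [folklore] -/
theorem instrCost_mono {L L' : ℕ} (h : L ≤ L') (W β P : ℕ) : instrCost L W β P ≤ instrCost L' W β P := by
  unfold instrCost; have := loadCost_mono h β; have := storeCost_mono h β; omega

/-- An iterate of the halted transition stays halted. [folklore] -/
theorem iterate_bind_none {M : Program} {W : ℕ} (n : ℕ) :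
    (flip bind (step M W noOracle zeroCoins))^[n] (none : Option Cfg) = none :=
  Function.iterate_fixed rfl n

/-- **Simulation of a halting run.** If the word RAM, started in a configuration `cfg` whose memory
is represented by the `β`-bounded log `E` (values `≤ V`, counter `≤ pcBound`), halts after `n`
steps in `c_f`, then the interpreter, started on the configuration file of `cfg` with the run flag
armed iff `cfg` is running, ends on the configuration file of `c_f` (some log representing its
memory, counter empty, flag down), within `n · (instrCost + 2 pcBound + 5) + 1` steps where the
log length entering `instrCost` is the uniform bound `(4β + 4)(|E| + n)`. [folklore] -/
theorem runs_interp {M : Program} {W β V : ℕ} (hwV : 2 ^ W - 1 ≤ V) (h1V : 1 ≤ V)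
    (hMV : Program.maxConst M ≤ V) (hβ : (encodeNat V).length ≤ β) :
    ∀ (n : ℕ) (cfg : Cfg) {c_f : Cfg} {E : List (List Bool × List Bool)},
      Represents E cfg.mem → BoundedLog β E → MemLE V cfg.mem → (∀ i, cfg.pc = some i → i ≤ pcBound M) →
      (flip bind (step M W noOracle zeroCoins))^[n] (some cfg) = some c_f → c_f.pc = none →
      ∃ E_f, Represents E_f c_f.mem ∧ BoundedLog β E_f ∧ E_f.length ≤ E.length + n ∧
        Runs (interp M) (state (cfgSt W E cfg.pc (flag cfg.pc.isSome)) F0) (state (cfgSt W E_f none []) F0)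
          (n * (instrCost ((4 * β + 4) * (E.length + n)) W β (pcBound M) + 2 * pcBound M + 5) + 1)
  | 0, cfg, c_f, E, hrep, hE, _, _, hit, hhalt => by
    simp only [Function.iterate_zero, id_eq, Option.some.injEq] at hit
    subst hit
    refine ⟨E, hrep, hE, by omega, ?_⟩
    rw [hhalt]
    exact (Runs.loop_nil _ _ (by simp [state, cfgSt, flag])).of_eq (by simp [flag]) (by simp)
  | n + 1, ⟨pc, mem, cp, qs⟩, c_f, E, hrep, hE, hV, hpcB, hit, hhalt => by
    rw [Function.iterate_succ_apply] at hit
    change (flip bind (step M W noOracle zeroCoins))^[n] (step M W noOracle zeroCoins ⟨pc, mem, cp, qs⟩) = some c_f at hit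
    cases pc with
    | none =>
      have : step M W noOracle zeroCoins ⟨none, mem, cp, qs⟩ = none := by unfold step; rfl
      rw [this, iterate_bind_none] at hit
      exact absurd hit (by simp)
    | some j =>
      cases hs : step M W noOracle zeroCoins ⟨some j, mem, cp, qs⟩ with
      | none => rw [hs, iterate_bind_none] at hit; exact absurd hit (by simp)
      | some cfg' =>
        rw [hs] at hit
        have hj : j ≤ pcBound M := hpcB j rfl
        obtain ⟨E', hrep', hE', hlen', hbody⟩ := runs_body_step hrep hE hV hwV h1V hMV hβ hj hs
        have hV' : MemLE V cfg'.mem := step_memLE hwV h1V hMV hV hs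
        obtain ⟨E_f, hrepf, hEf, hlenf, hrest⟩ := runs_interp hwV h1V hMV hβ n cfg' hrep' hE' hV'
          (fun i hi => step_pc_le_pcBound hs hi) hit hhalt
        refine ⟨E_f, hrepf, hEf, by omega, ?_⟩
        have hk : state (cfgSt W E (some j) (flag (some j).isSome)) F0 (Sum.inl K.run) = true :: [] := by
          simp [state, cfgSt, flag]
        have hupd : Function.update (state (cfgSt W E (some j) (flag (some j).isSome)) F0) (Sum.inl K.run) [] =
            state (cfgSt W E (some j) []) F0 := by
          simp [state, cfgSt]
        rw [← hupd] at hbody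
        refine (Runs.loop_true hk hbody hrest).of_eq rfl ?_
        -- the cost
        set P := pcBound M
        set X := instrCost ((4 * β + 4) * (E.length + (n + 1))) W β P with hX
        have hL : (encLog E).length ≤ (4 * β + 4) * (E.length + (n + 1)) :=
          le_trans (length_encLog_le hE) (Nat.mul_le_mul_left _ (by omega))
        have hB1 : instrCost (encLog E).length W β P ≤ X := instrCost_mono hL W β P
        have hL2 : (4 * β + 4) * (E'.length + n) ≤ (4 * β + 4) * (E.length + (n + 1)) :=
          Nat.mul_le_mul_left _ (by omega)
        have hB2 : instrCost ((4 * β + 4) * (E'.length + n)) W β P ≤ X := instrCost_mono hL2 W β P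
        have hmul : n * (instrCost ((4 * β + 4) * (E'.length + n)) W β P + 2 * P + 5) ≤ n * (X + 2 * P + 5) :=
          Nat.mul_le_mul_left _ (by omega)
        have e : (n + 1) * (X + 2 * P + 5) + 1 = (X + 2 * P + 3) + 2 + (n * (X + 2 * P + 5) + 1) := by ring
        rw [e]
        omega

/-! ### Logs with distinct keys -/

/-- In a log whose keys are pairwise distinct, every entry is found by its key, wherever it sits.
[folklore] -/
theorem logLookup_of_mem_of_nodup {E : List (List Bool × List Bool)} (hnd : (E.map Prod.fst).Nodup)
    {k v : List Bool} (h : (k, v) ∈ E) : logLookup E k = v := by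
  induction E with
  | nil => simp at h
  | cons e E ih =>
    simp only [List.map_cons, List.nodup_cons, List.mem_map, not_exists, not_and] at hnd
    simp only [logLookup]
    rcases List.mem_cons.1 h with rfl | h'
    · simp
    · have hne : e.1 ≠ k := fun he => hnd.1 (k, v) h' he.symm
      rw [if_neg hne]
      exact ih hnd.2 h'

/-- A key that does not occur reads `[]`. [folklore] -/
theorem logLookup_of_not_mem {E : List (List Bool × List Bool)} {k : List Bool} (h : k ∉ E.map Prod.fst) :
    logLookup E k = [] := by
  induction E with
  | nil => rfl
  | cons e E ih =>
    simp only [List.map_cons, List.mem_cons, not_or] at h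
    simp only [logLookup, if_neg (Ne.symm h.1)]
    exact ih h.2

/-! ### Reading the answer and cleaning up -/

/-- `readOutBit`: read cell `1` and record on `out` whether it holds `1` (for a machine whose
output is `[0]` or `[1]`, i.e. `mem 0 = 1`, `mem 1 ∈ {0, 1}`). [folklore] -/
def readOutBit : Com (K ⊕ AReg) :=
  ((push (Sum.inl K.key) true ;; memRead) ;; clear (Sum.inl K.key)) ;;
  pop (Sum.inl K.val) (push (Sum.inl K.out) true) (push (Sum.inl K.out) false) (push (Sum.inl K.out) false)

/-- Effect of `readOutBit` on a halted configuration file whose cell `1` holds `0` or `1`.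
[folklore] -/
theorem runs_readOutBit {W : ℕ} {E : List (List Bool × List Bool)} {mem : ℕ → ℕ} (hrep : Represents E mem)
    (hb : mem 1 = 0 ∨ mem 1 = 1) :
    Runs readOutBit (state (cfgSt W E none []) F0)
      (state { cfgSt W E none [] with out := [decide (mem 1 = 1)] } F0) ((encLog E).length * 20 + 16) := by
  have e1 : encodeNat 1 = [true] := by decide
  have e0 : encodeNat 0 = [] := by decide
  have h1 := Runs.push (Sum.inl K.key) true (state (cfgSt W E none []) F0)
  simp only [state, Sum.elim_inl, regs_key, cfgSt_key, Sum.update_elim_inl, update_regs_key] at h1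
  have h2 := h1.seq (runs_memRead _ _ E (encodeNat 1) (by simp) (by simp [e1]) (by simp) (by simp) (by simp) (by simp)
    (by simp) (by simp) (by simp) (by simp))
  have h3 := h2.seq (runs_clear (Sum.inl K.key : K ⊕ AReg) _)
  simp only [state, Sum.elim_inl, regs_key, Sum.update_elim_inl, update_regs_key, hrep.lookup 1, List.length_singleton]
    at h3
  rcases hb with hb | hb
  · rw [hb, e0] at h3
    have h4 := h3.seq (Runs.pop_nil (k := (Sum.inl K.val : K ⊕ AReg)) (push (Sum.inl K.out) true)
      (push (Sum.inl K.out) false) (by simp) (Runs.push (Sum.inl K.out) false _))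
    refine h4.of_eq ?_ (by simp [e1]; omega)
    simp [state, hb]
  · rw [hb, e1] at h3
    have h4 := h3.seq (Runs.pop_true' (k := (Sum.inl K.val : K ⊕ AReg)) (push (Sum.inl K.out) false)
      (push (Sum.inl K.out) false) (w := []) (by simp) rfl (Runs.push (Sum.inl K.out) true _))
    refine h4.of_eq ?_ (by simp; omega)
    simp [state, hb]

/-- `cleanup`: empty the registers that may still hold data at the end (log, ruler, run flag,
program counter, the numeral of `n`, the empty-clause flag). [folklore] -/
def cleanup : Com (K ⊕ AReg) :=
  ((((clear (Sum.inl K.mem) ;; clear (Sum.inl K.wr)) ;; clear (Sum.inl K.run)) ;; clear (Sum.inl K.pc)) ;;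
    clear (Sum.inl K.nb)) ;; clear (Sum.inl K.he)

/-- Effect of `cleanup`: from a file in which only `mem`, `wr`, `run`, `pc`, `nb`, `he`, `out` may
be nonempty, to the file holding `out` alone. [folklore] -/
theorem runs_cleanup (m w ru p nbv hev o : List Bool) :
    Runs cleanup (state { St.zero with mem := m, wr := w, run := ru, pc := p, nb := nbv, he := hev, out := o } F0)
      (state { St.zero with out := o } F0)
      (2 * (m.length + w.length + ru.length + p.length + nbv.length + hev.length) + 6) := by
  have h1 := (((((runs_clear (Sum.inl K.mem : K ⊕ AReg)
    (state { St.zero with mem := m, wr := w, run := ru, pc := p, nb := nbv, he := hev, out := o } F0)).seq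
    (runs_clear (Sum.inl K.wr : K ⊕ AReg) _)).seq
    (runs_clear (Sum.inl K.run : K ⊕ AReg) _)).seq (runs_clear (Sum.inl K.pc : K ⊕ AReg) _)).seq
    (runs_clear (Sum.inl K.nb : K ⊕ AReg) _)).seq (runs_clear (Sum.inl K.he : K ⊕ AReg) _)
  simp only [state, Sum.elim_inl, regs_mem, Sum.update_elim_inl, update_regs_mem, regs_wr, update_regs_wr, regs_run,
    update_regs_run, regs_pc, update_regs_pc, regs_nb, update_regs_nb, regs_he, update_regs_he] at h1
  refine h1.of_eq ?_ (by omega)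
  simp [state, St.zero]

/-- The initial register file of the machine: the input word on `inp`. [folklore] -/
theorem init_inp (z : List Bool) : Regs.init (Sum.inl K.inp : K ⊕ AReg) z = state { St.zero with inp := z } F0 := by
  funext i; rcases i with i | i <;> cases i <;> rfl

/-- The final register file of the machine: the answer on `out`. [folklore] -/
theorem init_out (z : List Bool) : Regs.init (Sum.inl K.out : K ⊕ AReg) z = state { St.zero with out := z } F0 := by
  funext i; rcases i with i | i <;> cases i <;> rfl

end Literature.Computability.Cryptography.WordRAM.ToTM2
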